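import Summits.HubbardSuperconductivity.HubbardSuperconductivity.Theses.BcsKacWindow

/-!
# Crux `InfraredCompletion` (stmt-HubbardSuperconductivity-1321, route BcsKacWindow), negative side:
# refuting the transfer PROVES the coherence window (what any `Disproof.lean` of this crux must do)

The typed crux `InfraredCompletion` is a transfer `∀ datum, guards → pins → W(datum) → Bulk(datum)`
whose antecedent W is VERBATIM the body of the route's rank-2 crux `CoherenceWindowLRO`
(`∃ datum, guards ∧ pins ∧ W(datum)`). Hence, by pure logic:

* `coherenceWindowLRO_of_not_infraredCompletion` — a counterexample to the transfer is a datum on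
  which the coherence window HOLDS (and bulk order fails); exhibiting it proves `CoherenceWindowLRO`.
  So refuting stmt-1321 is at least as hard as proving stmt-1319 (itself `open-problem`): the
  negation obstruction N1 of the crux strategist's census
  (`Cruxes/InfraredCompletion/STRATEGY-CENSUS.md`, `StrategistSketch.lean §N`, 2026-08-17), made
  citable by name for disprovers and line cards.
* `infraredCompletion_or_coherenceWindowLRO` — the same fact as a disjunction: the two thesis cruxes
  of route `BcsKacWindow` cannot both be false.
* `not_coherenceWindowLRO_iff_forall_not_window` — the contrapositive reading used by refuters: the
  window crux fails iff EVERY admissible datum violates W, in which case the transfer holds vacuously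
  (`infraredCompletion_of_not_coherenceWindowLRO`).

No physics is used; nothing here proves or refutes either crux. Negative-side support for the crux
(`--supports stmt-HubbardSuperconductivity-1321`; companion of `…/Negative/SqrtShapeNearGroundStates.lean`). This module imports the route file and is therefore
never to be imported by a CLOSING module of route `BcsKacWindow` (the gate links `<Decl>_holds` by
importing the closing module into the route file). [folklore: bookkeeping on quantifiers]
-/

noncomputable section

-- the mandated namespace `Summit.<Summit>.<Problem>.Theorems…` repeats `HubbardSuperconductivity`
-- (single-problem summit, D-0017), which the `dupNamespace` linter flags on every declaration
set_option linter.dupNamespace false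

namespace Summit.HubbardSuperconductivity.HubbardSuperconductivity.Theorems.InfraredCompletion.Negative

open Summit.HubbardSuperconductivity.HubbardSuperconductivity.Theses.BcsKacWindow
open scoped Matrix

/-- **Refuting the transfer proves the window.** If `InfraredCompletion` fails, some datum
`(a,b,κ₁,κ₂,c₀,s₀,Δ)` satisfies the guards, the flat pin and the coherence-window bound W (and violates
the bulk conclusion); that datum is a witness of `CoherenceWindowLRO`. Pure logic. [folklore] -/
theorem coherenceWindowLRO_of_not_infraredCompletion (h : ¬ InfraredCompletion) :
    CoherenceWindowLRO := by
  by_contra hW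
  apply h
  intro a b κ₁ κ₂ c₀ s₀ Δ ha hab hb hκ₁ hκ hc₀ hs₀ hpin hwin
  exact (hW ⟨a, b, κ₁, κ₂, c₀, s₀, Δ, ha, hab, hb, hκ₁, hκ, hc₀, hs₀, hpin, hwin⟩).elim

/-- **The two thesis cruxes of route `BcsKacWindow` cannot both be false.** [folklore] -/
theorem infraredCompletion_or_coherenceWindowLRO : InfraredCompletion ∨ CoherenceWindowLRO := by
  by_cases h : InfraredCompletion
  · exact Or.inl h
  · exact Or.inr (coherenceWindowLRO_of_not_infraredCompletion h)

/-- **Vacuous truth of the transfer.** If the coherence window fails for every admissible datum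
(`¬ CoherenceWindowLRO`), the transfer `InfraredCompletion` holds (vacuously). [folklore] -/
theorem infraredCompletion_of_not_coherenceWindowLRO (hW : ¬ CoherenceWindowLRO) :
    InfraredCompletion :=
  (infraredCompletion_or_coherenceWindowLRO.resolve_right hW)

/-- **Contrapositive reading.** `CoherenceWindowLRO` fails iff every datum satisfying the guards and the
flat pin VIOLATES the rate-free window bound W (some window top `s ≥ s₀` admits no `U₁(s)`).
[folklore] -/
theorem not_coherenceWindowLRO_iff_forall_not_window :
    ¬ CoherenceWindowLRO ↔
      ∀ (a b κ₁ κ₂ c₀ s₀ : ℝ) (Δ : ℝ → ℝ), 0 < a → a < b → b < 1 / 2 → 0 < κ₁ → κ₁ ≤ κ₂ → 0 < c₀ →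
        0 < s₀ →
        (∀ U : ℝ, 0 < U → Real.exp (-(κ₂ / U ^ 2)) ≤ Δ U ∧ Δ U ≤ Real.exp (-(κ₁ / U ^ 2))) →
        ¬ (∀ s : ℝ, s₀ ≤ s → ∃ U₁ : ℝ, 0 < U₁ ∧ ∀ δ ∈ Set.Icc a b, ∀ U ∈ Set.Ioo (0:ℝ) U₁,
            ∀ (L : ℕ) [NeZero L], Even L → s₀ ≤ Δ U * L → Δ U * L ≤ s →
              ∀ ψ : Literature.MathematicalPhysics.QuantumLattice.Fock
                  (Literature.MathematicalPhysics.QuantumLattice.Orb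
                    (Literature.MathematicalPhysics.QuantumLattice.FermionTorus 2 L)),
                star ψ ⬝ᵥ ψ = 1 →
                Literature.MathematicalPhysics.QuantumLattice.IsGroundStateInSector
                    (Literature.MathematicalPhysics.QuantumLattice.hubbardTorus 2 L 1 U)
                    (2 * ⌊(1 - δ) * (L : ℝ) ^ 2 / 2⌋₊) 0 ψ →
                  c₀ * Δ U ^ 2 ≤
                    (Literature.MathematicalPhysics.QuantumLattice.expect
                        ((Literature.MathematicalPhysics.QuantumLattice.pairField
                            Literature.MathematicalPhysics.QuantumLattice.dWaveFormFactor L)ᴴ *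
                          Literature.MathematicalPhysics.QuantumLattice.pairField
                            Literature.MathematicalPhysics.QuantumLattice.dWaveFormFactor L)
                        ψ).re / (L : ℝ) ^ 4) := by
  constructor
  · intro hW a b κ₁ κ₂ c₀ s₀ Δ ha hab hb hκ₁ hκ hc₀ hs₀ hpin hwin
    exact hW ⟨a, b, κ₁, κ₂, c₀, s₀, Δ, ha, hab, hb, hκ₁, hκ, hc₀, hs₀, hpin, hwin⟩
  · rintro h ⟨a, b, κ₁, κ₂, c₀, s₀, Δ, ha, hab, hb, hκ₁, hκ, hc₀, hs₀, hpin, hwin⟩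
    exact h a b κ₁ κ₂ c₀ s₀ Δ ha hab hb hκ₁ hκ hc₀ hs₀ hpin hwin

end Summit.HubbardSuperconductivity.HubbardSuperconductivity.Theorems.InfraredCompletion.Negative

end
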